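import Summits.QuantumFields.BalabanUV.Beta.SecondOrderInverseShapeDefect
import Summits.QuantumFields.BalabanUV.Beta.SecondOrderContactMmRead
import Summits.QuantumFields.BalabanUV.Beta.RelInvFactorSandwich

/-!
# `BalabanUV.Beta.SecondOrderContactMmReadDefect` — binder row D1, (N7a′) of the second-order hR slot port: **THE `mm`-READ OF `K3OfK(♯) − K3OfK` WITH
# THE SIMILARITY-SHAPE DEFECT, AND THE VANISHING OF THE PURE SANDWICH-DEFECT READS FROM BLOCK FACTS** — twins of
# `SecondOrderContactMmRead.mmRead_K3OfK_sharp_split` and `SecondOrderStepEval.mmRead_K3OfK_bref_sharp_split` with `Spr E`, `RelInv K 𝕄 E` and the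
# `E`-commutations REMOVED (β sub-cell, BINDER-OWNERS row D1 OWNER `b2b-balaban-beta-an2`, gen 31; memo `gen30/N7-SCOPE.v1.md` §4, RULING R-D1-g28-2)

HONEST FRAMING (cell charter, verbatim): «discharging BetaPertH makes Bałaban's UV stability UNCONDITIONAL — a real constructive-QFT result; it is
NOT the continuum limit and NOT the Clay problem.»  HONEST DEPENDENCY: continuum YM on T⁴ ⇐ BetaPertH ∧ nine spine estimates (0/9 proved); BetaPertH
⇐ (D1) ∧ (D4) ∧ CAP+tail; G-an2-4 gates asym, D1 and NE2/3/4.  DERIVED cell leaf: NEUTRAL KERNEL ALGEBRA ([folklore]) over the tree's own definitions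
(`BalabanStepJetsSucc.mmRead`, `WardLocusCubic.mmSym`, an5's `conjW`, K4c's `sandwichDefect`, gen-28's block-fact sandwich `RelInvFactorSandwich`); no
statement of Bałaban's papers, no `[cite:]`, no `def`, no `Prop` fact; instantiates no binder of the wall.  NOT D1, NOT `BetaPertH`, NOT continuum, NOT
Clay.

WHY.  `SecondOrderInverseShapeDefect.K3OfK_sharp_split_defect` gives `K3OfK` of the ♯-tables of similarity shape for an ARBITRARY spread pair `(K, 𝕄)`
at the price of the displayed defect `Δ₃` (seven words in the sandwich defects `S_X = sandwichDefect K 𝕄 X` of the letters `X_b`, `X_c`, `X_b∘X_c`,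
`X_c∘X_b`, `X₂`).  What the second-order recursion of the row-D1 literal consumes is the `mm`-READ of that identity (the level-`(j+1)` field–field table
is `mmRead Lc (K3OfK G_j …)`, `SpineRecursiveW.e4OfKW`).  §1: on the MULTIPLIER block the sandwich defect of every localised DIAGONAL letter VANISHES
under gen-28's four block facts `(𝕄∘K)_fm = 0`, `(K∘𝕄)_mf = 0`, `(𝕄∘K)_mm = (K∘𝕄)_mm = 1_coarse` (coarse multiplier legs of `K`) — a one-line
corollary of `RelInvFactorSandwich.mm_sandwich_conjV_diagK` (NO commutation hypothesis) — so the three PURE defect words `S_{X_b∘X_c}`, `S_{X_c∘X_b}`,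
`S_{X₂}` (diagonal letters: `SecondOrderContactForm.comp_diagK_diagK`) drop out of the read; §2: the `mm`-read of the assembled identity then displays
ONLY the four COMPOSED defect words `S_b∘(D_c∘K − X_c)`, `(K∘D♯_b)∘S_c` and `b ↔ c` (the «inner» words — for the literal they are commutator-valued,
`ChartConjugationRelativeSX.sandwichDefect_rel`, and are the objects an3's second-order audit W6–W8 ∕ the (N8) factorisation has to evaluate); §3:
composed with the `E`-free transport `SecondOrderStepTransport.mmRead_K3OfK_bref_sharp`, the twin of `SecondOrderStepEval.mmRead_K3OfK_bref_sharp_split`: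
the reflection law of the next level's field–field second-order table, EVALUATED, for an arbitrary reflection-invariant spread `K` and spread `𝕄` with
the four block facts — similarity shape against `mmRead N K` PLUS the read of the four inner defect words MINUS the transported remainder.
NOT HERE: the instance at the literal's `(Gsym j, bhKStepSh 3 Lc (Dsh Lc) j)` (block facts = `RelInvFactorSandwich` §4 under (Dspr)(Dnull)(DG)) with the
coarse generator symbols rewritten (`mmSym_dressedGen_inl` needs rule 4 `E∘𝕄∘K = E` at the centred root) — (N7b)'s level step.
Provenance: β sub-cell, unit beta-an2 gen 31, 2026-08-21 (v1); over `SecondOrderInverseShapeDefect` (this gen), `SecondOrderContactMmRead`,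
`SecondOrderStepTransport`, `RelInvFactorSandwich`, `SecondOrderContactForm` BY NAME; no existing file touched.
-/

open Finset
open scoped BigOperators
open Literature.Probability.LatticeModels (Torus.proj)
open Literature.MathematicalPhysics.QuantumFieldTheory
open Literature.MathematicalPhysics.QuantumFieldTheory.Balaban1983to89
open Literature.MathematicalPhysics.QuantumFieldTheory.Balaban1983to89.Beta
open ExpKernelCalculus (MKer Decays BiLoc comp)
open PolarizationSign (reflSign)
open KernelReflection (refK)
open ResolventReflection (bref Φ)
open OneStepResolventKernel (Fib)
open OneStepKernelFamily (colH)
open BalabanStepJetsSucc (mmRead mmRead_inl_inl mmRead_inr_left mmRead_inr_right)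
open SecondOrderResponse (dM K2OfK)
open BalabanStepW2 (K3OfK)
open Summit.QuantumFields.BalabanUV.Beta.TameKernelCalculus
open Summit.QuantumFields.BalabanUV.Beta.ChartConjugation (conjV conjW loc_conjV loc_conjW)
open Summit.QuantumFields.BalabanUV.Beta.BorderedHessian (diagK)
open Summit.QuantumFields.BalabanUV.Beta.WardLocusCubic (mmSym)
open Summit.QuantumFields.BalabanUV.Beta.SecondOrderContactForm (dM_table_sharp_split comp_diagK_diagK)
open Summit.QuantumFields.BalabanUV.Beta.SecondOrderStepTransport (mmRead_K3OfK_bref_sharp)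
open Summit.QuantumFields.BalabanUV.Beta.SecondOrderContactMmRead (mmRead_conjW_diag)
open Summit.QuantumFields.BalabanUV.Beta.ChartConjugationDefectEnd (sandwichDefect sandwichDefect_eq loc_sandwichDefect')
open Summit.QuantumFields.BalabanUV.Beta.SecondOrderInverseShapeDefect (K3OfK_sharp_split_defect)
open Summit.QuantumFields.BalabanUV.Beta.RelInvFactorSandwich (mm_sandwich_conjV_diagK)
open Summit.QuantumFields.BalabanUV.Beta.VertexReflectionContact (mmRead_add mmRead_neg)
open Summit.QuantumFields.BalabanUV.Beta.GAN24.ThirdJetKernel (mmRead_sub)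

namespace Summit.QuantumFields.BalabanUV.Beta.SecondOrderContactMmReadDefect

noncomputable section

variable {d N : ℕ}

/-! ## §1 The `mm`-read of the sandwich defect of a diagonal letter vanishes from block facts -/

section PureDefect

variable {K 𝕄 : MKer (d + 1) (Fib d)}

/-- [folklore] **THE SANDWICH DEFECT OF A LOCALISED DIAGONAL LETTER HAS NO `mm`-READ** — from the four block facts of gen 28, NO commutation
hypothesis: `mmRead N (sandwichDefect K 𝕄 (diagK g)) = 0` (`RelInvFactorSandwich.mm_sandwich_conjV_diagK`: on the multiplier block
`K∘conjV 𝕄 (diagK g)∘K = −conjV K (diagK g)`). -/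
theorem mmRead_sandwichDefect_diagK_eq_zero (hK : Spr K) (hM : Spr 𝕄) (g : (Fin (d + 1) → ℤ) → Fib d → ℝ) (hg : Loc (diagK g))
    (hKrow : ∀ (x z : Fin (d + 1) → ℤ) (m : Fin (d + 1)) (b : Fib d), Torus.proj N x ≠ 0 → K x z (Sum.inr m) b = 0)
    (hKcol : ∀ (x z : Fin (d + 1) → ℤ) (a : Fib d) (m : Fin (d + 1)), Torus.proj N z ≠ 0 → K x z a (Sum.inr m) = 0)
    (hMKfm : ∀ (x z : Fin (d + 1) → ℤ) (a m : Fin (d + 1)), comp 𝕄 K x z (Sum.inl a) (Sum.inr m) = 0)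
    (hKMmf : ∀ (x z : Fin (d + 1) → ℤ) (m a : Fin (d + 1)), comp K 𝕄 x z (Sum.inr m) (Sum.inl a) = 0)
    (hMKmm : ∀ (x z : Fin (d + 1) → ℤ) (m m' : Fin (d + 1)), Torus.proj N x = 0 → Torus.proj N z = 0 →
      comp 𝕄 K x z (Sum.inr m) (Sum.inr m') = if x = z ∧ m = m' then 1 else 0)
    (hKMmm : ∀ (x z : Fin (d + 1) → ℤ) (m m' : Fin (d + 1)), Torus.proj N x = 0 → Torus.proj N z = 0 →
      comp K 𝕄 x z (Sum.inr m) (Sum.inr m') = if x = z ∧ m = m' then 1 else 0) :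
    mmRead N (sandwichDefect K 𝕄 (diagK g)) = 0 := by
  funext x' z' a b
  rcases a with α | m <;> rcases b with β | m'
  · rw [mmRead_inl_inl, sandwichDefect_eq, Pi.add_apply, Pi.add_apply, Pi.add_apply, Pi.add_apply,
      mm_sandwich_conjV_diagK hK hM g hg hKrow hKcol hMKfm hKMmf hMKmm hKMmm, neg_add_cancel]
    rfl
  · rfl
  · rfl
  · rfl

/-- [folklore] The same for the PRODUCT of two localised diagonal letters (a diagonal letter, `SecondOrderContactForm.comp_diagK_diagK`). -/
theorem mmRead_sandwichDefect_diagK_comp_eq_zero (hK : Spr K) (hM : Spr 𝕄) (g g' : (Fin (d + 1) → ℤ) → Fib d → ℝ) (hg : Loc (diagK g))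
    (hg' : Loc (diagK g'))
    (hKrow : ∀ (x z : Fin (d + 1) → ℤ) (m : Fin (d + 1)) (b : Fib d), Torus.proj N x ≠ 0 → K x z (Sum.inr m) b = 0)
    (hKcol : ∀ (x z : Fin (d + 1) → ℤ) (a : Fib d) (m : Fin (d + 1)), Torus.proj N z ≠ 0 → K x z a (Sum.inr m) = 0)
    (hMKfm : ∀ (x z : Fin (d + 1) → ℤ) (a m : Fin (d + 1)), comp 𝕄 K x z (Sum.inl a) (Sum.inr m) = 0)
    (hKMmf : ∀ (x z : Fin (d + 1) → ℤ) (m a : Fin (d + 1)), comp K 𝕄 x z (Sum.inr m) (Sum.inl a) = 0)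
    (hMKmm : ∀ (x z : Fin (d + 1) → ℤ) (m m' : Fin (d + 1)), Torus.proj N x = 0 → Torus.proj N z = 0 →
      comp 𝕄 K x z (Sum.inr m) (Sum.inr m') = if x = z ∧ m = m' then 1 else 0)
    (hKMmm : ∀ (x z : Fin (d + 1) → ℤ) (m m' : Fin (d + 1)), Torus.proj N x = 0 → Torus.proj N z = 0 →
      comp K 𝕄 x z (Sum.inr m) (Sum.inr m') = if x = z ∧ m = m' then 1 else 0) :
    mmRead N (sandwichDefect K 𝕄 (comp (diagK g) (diagK g'))) = 0 := by
  have hgg : Loc (diagK fun p a => g p a * g' p a) := by rw [← comp_diagK_diagK]; exact hg.comp hg'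
  rw [comp_diagK_diagK]
  exact mmRead_sandwichDefect_diagK_eq_zero hK hM _ hgg hKrow hKcol hMKfm hKMmf hMKmm hKMmm

end PureDefect

/-! ## §2 The assembled `mm`-read of `K3OfK(♯) − K3OfK`, no inverse relation: only the four composed defect words survive -/

section Assembled

variable {K 𝕄 : MKer (d + 1) (Fib d)}

/-- [folklore] **THE ASSEMBLED `mm`-READ OF `K3OfK` OF THE ♯-TABLES, NO INVERSE RELATION** (twin of `SecondOrderContactMmRead.mmRead_K3OfK_sharp_split`
with `Spr E`, `RelInv K 𝕄 E` and the `E`-commutations REPLACED by the four block facts of the pair `(K, 𝕄)` and the coarse multiplier legs of `K`):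
`mmRead N (K3OfK K N S♯ M W♯ b c) = mmRead N (K3OfK K N S M W b c)
   + conjW (mmRead N K) (mmRead N (K2OfK … b)) (mmRead N (K2OfK … c)) (diagK (mmSym N (G b))) (diagK (mmSym N (G c))) (diagK (mmSym N h)) − mmRead N (K∘R b c∘K)
   + mmRead N (S_b∘(D_c∘K − X_c)) + mmRead N ((K∘D♯_b)∘S_c) + mmRead N (S_c∘(D_b∘K − X_b)) + mmRead N ((K∘D♯_c)∘S_b)`
(`X_b = diagK (G b)`, `S_b = sandwichDefect K 𝕄 X_b`, `D_b = dM K N S M b`, `D♯_b = D_b + conjV 𝕄 X_b`, `X₂ = diagK h`) — the three PURE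
sandwich-defect words of `Δ₃` have NO `mm`-read (§1). -/
theorem mmRead_K3OfK_sharp_split_defect (hKs : Spr K) (h𝕄 : Spr 𝕄)
    (hKrow : ∀ (x z : Fin (d + 1) → ℤ) (m : Fin (d + 1)) (b : Fib d), Torus.proj N x ≠ 0 → K x z (Sum.inr m) b = 0)
    (hKcol : ∀ (x z : Fin (d + 1) → ℤ) (a : Fib d) (m : Fin (d + 1)), Torus.proj N z ≠ 0 → K x z a (Sum.inr m) = 0)
    (hMKfm : ∀ (x z : Fin (d + 1) → ℤ) (a m : Fin (d + 1)), comp 𝕄 K x z (Sum.inl a) (Sum.inr m) = 0)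
    (hKMmf : ∀ (x z : Fin (d + 1) → ℤ) (m a : Fin (d + 1)), comp K 𝕄 x z (Sum.inr m) (Sum.inl a) = 0)
    (hMKmm : ∀ (x z : Fin (d + 1) → ℤ) (m m' : Fin (d + 1)), Torus.proj N x = 0 → Torus.proj N z = 0 →
      comp 𝕄 K x z (Sum.inr m) (Sum.inr m') = if x = z ∧ m = m' then 1 else 0)
    (hKMmm : ∀ (x z : Fin (d + 1) → ℤ) (m m' : Fin (d + 1)), Torus.proj N x = 0 → Torus.proj N z = 0 →
      comp K 𝕄 x z (Sum.inr m) (Sum.inr m') = if x = z ∧ m = m' then 1 else 0)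
    {S M : Fin (d + 1) → (Fin (d + 1) → ℤ) → MKer (d + 1) (Fib d)}
    {g : Fin (d + 1) → (Fin (d + 1) → ℤ) → (Fin (d + 1) → ℤ) → Fib d → ℝ}
    {W R : Fin (d + 1) → (Fin (d + 1) → ℤ) → Fin (d + 1) → (Fin (d + 1) → ℤ) → MKer (d + 1) (Fib d)}
    {h : Fin (d + 1) → (Fin (d + 1) → ℤ) → Fin (d + 1) → (Fin (d + 1) → ℤ) → (Fin (d + 1) → ℤ) → Fib d → ℝ}
    (μ : Fin (d + 1)) (y : Fin (d + 1) → ℤ) (ν : Fin (d + 1)) (y' : Fin (d + 1) → ℤ)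
    (hS : ∀ (μ : Fin (d + 1)) (y : Fin (d + 1) → ℤ) (κ : Fin (d + 1)) (x z : Fin (d + 1) → ℤ) (a b : Fib d),
      Summable fun u => colH K N μ y κ u * S κ u x z a b)
    (hg : ∀ (μ : Fin (d + 1)) (y : Fin (d + 1) → ℤ) (κ : Fin (d + 1)) (p : Fin (d + 1) → ℤ) (c : Fib d),
      Summable fun u => colH K N μ y κ u * g κ u p c)
    (hDb : Loc (dM K N S M μ y)) (hDc : Loc (dM K N S M ν y')) (hW : Loc (W μ y ν y')) (hRm : Loc (R μ y ν y'))
    (hGb : Loc (diagK fun p c => ∑ κ, ∑' u, colH K N μ y κ u * g κ u p c))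
    (hGc : Loc (diagK fun p c => ∑ κ, ∑' u, colH K N ν y' κ u * g κ u p c)) (hX₂ : Loc (diagK (h μ y ν y'))) :
    mmRead N (K3OfK K N (fun κ u => S κ u + conjV 𝕄 (diagK (g κ u))) M
        (fun μ y ν y' => W μ y ν y' +
          conjW 𝕄 (dM K N S M μ y) (dM K N S M ν y') (diagK fun p c => ∑ κ, ∑' u, colH K N μ y κ u * g κ u p c)
            (diagK fun p c => ∑ κ, ∑' u, colH K N ν y' κ u * g κ u p c) (diagK (h μ y ν y')) + R μ y ν y') μ y ν y') =
      mmRead N (K3OfK K N S M W μ y ν y') +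
        conjW (mmRead N K) (mmRead N (K2OfK K N S M μ y)) (mmRead N (K2OfK K N S M ν y'))
          (diagK (mmSym N fun p c => ∑ κ, ∑' u, colH K N μ y κ u * g κ u p c))
          (diagK (mmSym N fun p c => ∑ κ, ∑' u, colH K N ν y' κ u * g κ u p c)) (diagK (mmSym N (h μ y ν y'))) -
        mmRead N (comp (comp K (R μ y ν y')) K)
        + (mmRead N (comp (sandwichDefect K 𝕄 (diagK fun p c => ∑ κ, ∑' u, colH K N μ y κ u * g κ u p c))
              (comp (dM K N S M ν y') K - diagK fun p c => ∑ κ, ∑' u, colH K N ν y' κ u * g κ u p c))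
          + mmRead N (comp (comp K (dM K N S M μ y + conjV 𝕄 (diagK fun p c => ∑ κ, ∑' u, colH K N μ y κ u * g κ u p c)))
              (sandwichDefect K 𝕄 (diagK fun p c => ∑ κ, ∑' u, colH K N ν y' κ u * g κ u p c)))
          + mmRead N (comp (sandwichDefect K 𝕄 (diagK fun p c => ∑ κ, ∑' u, colH K N ν y' κ u * g κ u p c))
              (comp (dM K N S M μ y) K - diagK fun p c => ∑ κ, ∑' u, colH K N μ y κ u * g κ u p c))
          + mmRead N (comp (comp K (dM K N S M ν y' + conjV 𝕄 (diagK fun p c => ∑ κ, ∑' u, colH K N ν y' κ u * g κ u p c)))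
              (sandwichDefect K 𝕄 (diagK fun p c => ∑ κ, ∑' u, colH K N μ y κ u * g κ u p c)))) := by
  rw [K3OfK_sharp_split_defect hKs h𝕄 (X₂ := fun μ y ν y' => diagK (h μ y ν y')) μ y ν y' hS hg hDb hDc hW hRm hGb hGc hX₂]
  simp only [mmRead_add, mmRead_sub]
  rw [mmRead_conjW_diag, mmRead_sandwichDefect_diagK_comp_eq_zero hKs h𝕄 _ _ hGb hGc hKrow hKcol hMKfm hKMmf hMKmm hKMmm,
    mmRead_sandwichDefect_diagK_comp_eq_zero hKs h𝕄 _ _ hGc hGb hKrow hKcol hMKfm hKMmf hMKmm hKMmm,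
    mmRead_sandwichDefect_diagK_eq_zero hKs h𝕄 _ hX₂ hKrow hKcol hMKfm hKMmf hMKmm hKMmm]
  abel

end Assembled

/-! ## §3 Transport + evaluation: the reflection law of the next level's field–field table, no inverse relation -/

section Eval

variable {K 𝕄 : MKer (d + 1) (Fib d)} [NeZero N]

/-- [folklore] **THE REFLECTION LAW OF THE NEXT LEVEL'S FIELD–FIELD SECOND-ORDER TABLE, EVALUATED — NO INVERSE RELATION** (twin of
`SecondOrderStepEval.mmRead_K3OfK_bref_sharp_split`).  For a spread, reflection-invariant packed kernel `K` and a spread `𝕄` with the four block facts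
(`(𝕄∘K)_fm = 0`, `(K∘𝕄)_mf = 0`, the two `mm` blocks the coarse identity) and coarse multiplier legs of `K`; first-order tables `S`, `M` with the sharp
laws `S κ (bref u) = ε • refK (S κ u + conjV 𝕄 (diagK (g κ u)))`, `M ρ (bref w) = ε • refK (M ρ w)`; a second-order table `W` whose sharp law has a
♯-bi-table OF SIMILARITY SHAPE UP TO A REMAINDER; and the localisations ∕ summabilities of the letters:
`mmRead N (K3OfK K N S M W μ (bref y) ν (bref y′)) = (ε_μ ε_ν) • refK (Φ N′ α) ( mmRead N (K3OfK K N S M W μ y ν y′)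
    + conjW (mmRead N K) (mmRead N (K2OfK … b)) (mmRead N (K2OfK … c)) (diagK (mmSym N (G b))) (diagK (mmSym N (G c))) (diagK (mmSym N (h b c)))
    − mmRead N (K ∘ R b c ∘ K) + [the `mm`-reads of the four composed sandwich-defect words] )`. -/
theorem mmRead_K3OfK_bref_sharp_split_defect (N' : ℕ) {α : Fin (d + 1)} (hK : refK (Φ N α) K = K) (hKs : Spr K) (h𝕄 : Spr 𝕄)
    (hKrow : ∀ (x z : Fin (d + 1) → ℤ) (m : Fin (d + 1)) (b : Fib d), Torus.proj N x ≠ 0 → K x z (Sum.inr m) b = 0)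
    (hKcol : ∀ (x z : Fin (d + 1) → ℤ) (a : Fib d) (m : Fin (d + 1)), Torus.proj N z ≠ 0 → K x z a (Sum.inr m) = 0)
    (hMKfm : ∀ (x z : Fin (d + 1) → ℤ) (a m : Fin (d + 1)), comp 𝕄 K x z (Sum.inl a) (Sum.inr m) = 0)
    (hKMmf : ∀ (x z : Fin (d + 1) → ℤ) (m a : Fin (d + 1)), comp K 𝕄 x z (Sum.inr m) (Sum.inl a) = 0)
    (hMKmm : ∀ (x z : Fin (d + 1) → ℤ) (m m' : Fin (d + 1)), Torus.proj N x = 0 → Torus.proj N z = 0 →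
      comp 𝕄 K x z (Sum.inr m) (Sum.inr m') = if x = z ∧ m = m' then 1 else 0)
    (hKMmm : ∀ (x z : Fin (d + 1) → ℤ) (m m' : Fin (d + 1)), Torus.proj N x = 0 → Torus.proj N z = 0 →
      comp K 𝕄 x z (Sum.inr m) (Sum.inr m') = if x = z ∧ m = m' then 1 else 0)
    {S M : Fin (d + 1) → (Fin (d + 1) → ℤ) → MKer (d + 1) (Fib d)}
    {g : Fin (d + 1) → (Fin (d + 1) → ℤ) → (Fin (d + 1) → ℤ) → Fib d → ℝ}
    {W R : Fin (d + 1) → (Fin (d + 1) → ℤ) → Fin (d + 1) → (Fin (d + 1) → ℤ) → MKer (d + 1) (Fib d)}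
    {h : Fin (d + 1) → (Fin (d + 1) → ℤ) → Fin (d + 1) → (Fin (d + 1) → ℤ) → (Fin (d + 1) → ℤ) → Fib d → ℝ}
    (hS : ∀ κ u, S κ (bref α κ u) = reflSign α κ • refK (Φ N α) (S κ u + conjV 𝕄 (diagK (g κ u))))
    (hM : ∀ ρ w, M ρ (bref α ρ w) = reflSign α ρ • refK (Φ N α) (M ρ w))
    (hW : ∀ μ y ν y', W μ (bref α μ y) ν (bref α ν y') = (reflSign α μ * reflSign α ν) • refK (Φ N α)
      (W μ y ν y' + conjW 𝕄 (dM K N S M μ y) (dM K N S M ν y') (diagK fun p c => ∑ κ, ∑' u, colH K N μ y κ u * g κ u p c)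
        (diagK fun p c => ∑ κ, ∑' u, colH K N ν y' κ u * g κ u p c) (diagK (h μ y ν y')) + R μ y ν y'))
    (hSs : ∀ (μ : Fin (d + 1)) (y : Fin (d + 1) → ℤ) (κ : Fin (d + 1)) (x z : Fin (d + 1) → ℤ) (a b : Fib d),
      Summable fun u => colH K N μ y κ u * S κ u x z a b)
    (hg : ∀ (μ : Fin (d + 1)) (y : Fin (d + 1) → ℤ) (κ : Fin (d + 1)) (p : Fin (d + 1) → ℤ) (c : Fib d),
      Summable fun u => colH K N μ y κ u * g κ u p c)
    (hD : ∀ ν y', Loc (dM K N S M ν y')) (hWl : ∀ μ y ν y', Loc (W μ y ν y')) (hRl : ∀ μ y ν y', Loc (R μ y ν y'))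
    (hGl : ∀ μ y, Loc (diagK fun p c => ∑ κ, ∑' u, colH K N μ y κ u * g κ u p c)) (hhl : ∀ μ y ν y', Loc (diagK (h μ y ν y')))
    (μ : Fin (d + 1)) (y : Fin (d + 1) → ℤ) (ν : Fin (d + 1)) (y' : Fin (d + 1) → ℤ) :
    mmRead N (K3OfK K N S M W μ (bref α μ y) ν (bref α ν y')) =
      (reflSign α μ * reflSign α ν) • refK (Φ (d := d) N' α)
        (mmRead N (K3OfK K N S M W μ y ν y') +
          conjW (mmRead N K) (mmRead N (K2OfK K N S M μ y)) (mmRead N (K2OfK K N S M ν y'))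
            (diagK (mmSym N fun p c => ∑ κ, ∑' u, colH K N μ y κ u * g κ u p c))
            (diagK (mmSym N fun p c => ∑ κ, ∑' u, colH K N ν y' κ u * g κ u p c)) (diagK (mmSym N (h μ y ν y'))) -
          mmRead N (comp (comp K (R μ y ν y')) K)
          + (mmRead N (comp (sandwichDefect K 𝕄 (diagK fun p c => ∑ κ, ∑' u, colH K N μ y κ u * g κ u p c))
                (comp (dM K N S M ν y') K - diagK fun p c => ∑ κ, ∑' u, colH K N ν y' κ u * g κ u p c))
            + mmRead N (comp (comp K (dM K N S M μ y + conjV 𝕄 (diagK fun p c => ∑ κ, ∑' u, colH K N μ y κ u * g κ u p c)))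
                (sandwichDefect K 𝕄 (diagK fun p c => ∑ κ, ∑' u, colH K N ν y' κ u * g κ u p c)))
            + mmRead N (comp (sandwichDefect K 𝕄 (diagK fun p c => ∑ κ, ∑' u, colH K N ν y' κ u * g κ u p c))
                (comp (dM K N S M μ y) K - diagK fun p c => ∑ κ, ∑' u, colH K N μ y κ u * g κ u p c))
            + mmRead N (comp (comp K (dM K N S M ν y' + conjV 𝕄 (diagK fun p c => ∑ κ, ∑' u, colH K N ν y' κ u * g κ u p c)))
                (sandwichDefect K 𝕄 (diagK fun p c => ∑ κ, ∑' u, colH K N μ y κ u * g κ u p c))))) := by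
  -- the ♯-tables as families, and the localisation of `dM K N S♯ M ·` and of `W♯`
  have hD' : ∀ ν y', Loc (dM K N (fun κ u => S κ u + conjV 𝕄 (diagK (g κ u))) M ν y') := fun ν y' => by
    rw [dM_table_sharp_split N 𝕄 K S M ν y' (hSs ν y') hg]
    exact (hD ν y').add (loc_conjV h𝕄 (hGl ν y'))
  have hWl' : ∀ μ y ν y', Loc (W μ y ν y' +
      conjW 𝕄 (dM K N S M μ y) (dM K N S M ν y') (diagK fun p c => ∑ κ, ∑' u, colH K N μ y κ u * g κ u p c)
        (diagK fun p c => ∑ κ, ∑' u, colH K N ν y' κ u * g κ u p c) (diagK (h μ y ν y')) + R μ y ν y') := fun μ y ν y' =>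
    ((hWl μ y ν y').add (loc_conjW h𝕄 (hD μ y) (hD ν y') (hGl μ y) (hGl ν y') (hhl μ y ν y'))).add (hRl μ y ν y')
  rw [mmRead_K3OfK_bref_sharp N' hK hKs hS hM
      (Wg := fun μ y ν y' => W μ y ν y' +
        conjW 𝕄 (dM K N S M μ y) (dM K N S M ν y') (diagK fun p c => ∑ κ, ∑' u, colH K N μ y κ u * g κ u p c)
          (diagK fun p c => ∑ κ, ∑' u, colH K N ν y' κ u * g κ u p c) (diagK (h μ y ν y')) + R μ y ν y')
      hW hD' hWl' μ y ν y',
    mmRead_K3OfK_sharp_split_defect hKs h𝕄 hKrow hKcol hMKfm hKMmf hMKmm hKMmm μ y ν y' hSs hg (hD μ y) (hD ν y') (hWl μ y ν y')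
      (hRl μ y ν y') (hGl μ y) (hGl ν y') (hhl μ y ν y')]

end Eval

end

end Summit.QuantumFields.BalabanUV.Beta.SecondOrderContactMmReadDefect
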